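import Mathlib
import HarnessLib
import Summits.ValiantsHypothesis.ValiantsHypothesis.Theorems.BarrierLeverPartitionMinorsHitByVPHiddenStatesBall
import Summits.ValiantsHypothesis.ValiantsHypothesis.Theorems.BarrierLeverPartitionMinorsHitByVPHiddenStatesSimplex

/-!
# Route BarrierLever — item `PartitionMinorsHitByVP` (stmt-ValiantsHypothesis-19717):
# CONJECTURE CB («COMPLETE Hamming balls are universal»), typed Theorems-side, with its falsifier record

Helper file (`--supports stmt-ValiantsHypothesis-19717`; cell valiant-natproofs, rung V4, 𝒟-side of door (c);
prover seat val-np-p3 gen 8). Closes NO item. One Theorems-side predicate (`CompleteBallsUniversal`, no assertion), per the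
director's standing rule «killable conjectures = Theorems-side def + arrow + falsifier, never items».

`HiddenStates.BallGood h K r u` (val-np-p3 g6) asks that the additive matrix of the row family `u` against the
ball–colex threshold family of size `r` on `K` states be nonsingular for some table. At the COMPLETE sizes
`r = |B_s(K)| = Σ_{j ≤ s} C(K, j)` that threshold family is the complete Hamming ball `{J : |J| ≤ s}` — no partial
colex layer, so the star/biclique obstruction of `…HiddenStatesStar(Param)` (which lives at the incomplete size
`r = h + 6`) does not apply. CONJECTURE CB of the seat memo (HOME/val-np-p3/g8/MEMO-joins-completeballs-valnp3-g8.md):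

* `CompleteBallsUniversal` — for all `h ≥ 3` and `s ≤ h`, EVERY injective family of `|B_s(h)|` subsets of `Fin h` is
  `BallGood h h |B_s(h)|` (`K = h`).

EVIDENCE (exact arithmetic mod primes; lab + kit, all `--workitem 19717`): TRUE for every lower set at `h = 4, 5` (every `s`)
and at `h = 6`, `s = 2` (all 144 505 lower sets of size 22; kit j287349 — and `B_2(7)`, `K = h+1`, for all 430 280 lower sets
of size 29); true for ALL families (not only lower sets) at `h = 4` and at `(h, s) = (5, 1)` (906 192 families; kit j288088);
0 failures in 995 adversarial + random families at `h = 7, 8, 9` and in all sampled families at `h = 10, 11` (kit j287348, j287859).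
FALSIFIER RULE: the complete ball with `K ≥ h + 3` states is NOT universal (families of sets of size `≤ s+1`, e.g. `h = 9`,
`K = 12`, `s = 2`), so the conjecture is stated at `K = h` (numerically `K = h + 1` is also clean).

USE. Through the JOIN door (`…HiddenStatesJoin.partitionMinorsHitByVP_of_universalJoin'`) every `r ≤ 2^h` is a disjoint union
of complete balls (`≤ h+1` pieces with `K = h`, plus a simplex), so CB together with the non-cancellation of the Laplace
expansion between independent pieces (memo §3, «Plücker spanning», verified at `h = 4`) gives item 19717 with `b = 8`.
Here only the direct consequence at complete sizes is recorded (`partitionMinor_hit_of_completeBalls`).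

WHAT THIS IS NOT: CB is OPEN; nothing is claimed about incomplete sizes, CPM (20172/20195), crux 14610 or VP ≠ VNP.
-/

set_option linter.dupNamespace false

namespace Summit.ValiantsHypothesis.ValiantsHypothesis.Theorems.BarrierLever.HiddenStates

open Finset

noncomputable section

/-- `|B_s(K)| = Σ_{j ≤ s} C(K, j)`, the size of the complete Hamming ball of radius `s` on `K` states. -/
def ballCard (K s : ℕ) : ℕ := ∑ j ∈ Finset.range (s + 1), K.choose j

/-- **CONJECTURE CB (complete Hamming balls are universal; `K = h`).** For every `h ≥ 3`, `s ≤ h` and every injective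
family `u` of `|B_s(h)|` subsets of `Fin h`, the additive matrix of `u` against the ball–colex family of that (complete)
size — the complete ball `{J ⊆ Fin h : |J| ≤ s}` — is nonsingular for some table. (Theorems-side killable conjecture; no
assertion. Evidence and falsifier rule in the module docstring.) -/
@[conjecture] def CompleteBallsUniversal : Prop :=
  ∀ h s : ℕ, 3 ≤ h → s ≤ h → ∀ u : Fin (ballCard h s) → Finset (Fin h), Function.Injective u →
    BallGood h h (ballCard h s) u

/-- `|B_s(K)| ≤ 2^K`. -/
theorem ballCard_le_two_pow (K s : ℕ) : ballCard K s ≤ 2 ^ K := by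
  unfold ballCard
  calc ∑ j ∈ Finset.range (s + 1), K.choose j ≤ ∑ j ∈ Finset.range (K + 1), K.choose j := by
        apply Finset.sum_le_sum_of_ne_zero
        intro j hj hne
        rw [Finset.mem_range]
        have : j ≤ K := by
          by_contra hlt
          exact hne (Nat.choose_eq_zero_of_lt (by omega))
        omega
    _ = 2 ^ K := Nat.sum_range_choose K

/-- **CB at complete sizes ⇒ the layouts of complete size are hit.** Under `CompleteBallsUniversal`, every layout
`(u, w)` with `h ≥ 5` whose size is a complete ball size `|B_s(h)|` (`s ≤ h`) is hit inside `SmallCircuits ℂ (h+h) 6`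
(both sides certified against the same complete ball; `HiddenStates.partitionMinor_hit_of_ballGood_pair`). -/
theorem partitionMinor_hit_of_completeBalls (H : CompleteBallsUniversal) (h s : ℕ) (hh : 5 ≤ h) (hs : s ≤ h)
    (u w : Fin (ballCard h s) → Finset (Fin h)) (hu : Function.Injective u) (hw : Function.Injective w) :
    ∃ f ∈ Literature.Barriers.ValiantsHypothesis.SmallCircuits ℂ (h + h) 6,
      (Matrix.of fun i j : Fin (ballCard h s) => MvPolynomial.coeff
        (∑ a ∈ u i, Finsupp.single (Fin.castAdd h a) 1 +
          ∑ c ∈ w j, Finsupp.single (Fin.natAdd h c) 1) f).det ≠ 0 :=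
  partitionMinor_hit_of_ballGood_pair h h (ballCard h s) hh le_rfl (Nat.le_mul_of_pos_left h (by omega)) u w hu
    (H h s (by omega) hs u hu) (H h s (by omega) hs w hw)

/-! ## STATUS (same seat, 2026-08-27T22:30Z): `CompleteBallsUniversal` is NUMERICALLY REFUTED at `h = 12`

Kit j287859 (family 'subcube2' at `h = 11`, `K = 12`) and a seat check at `h = 12`, `K = 12`, `s = 2`: for `u` = the
`79 = |B_2(12)|` smallest subsets of a 9-element subset of `Fin 12` (`∅`, 9 singletons, 36 pairs, 33 triples — a LOWER
SET) the additive matrix against the complete ball `B_2(12)` has corank `2` for every sampled table (independent random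
tables, exact arithmetic mod `2^61 − 1`); replacing two of the triples by sets meeting the three unused coordinates restores
full rank. MECHANISM: `GOOD` only sees the projection of the hidden configuration to the coordinates a family uses, so a
family concentrated on `h' ≤ K − 3` coordinates with faces of size `≤ s + 1` meets the «too many states» obstruction of the
seat memo §3 (complete balls `B_s(K)` fail against ball-like families once `K ≥ h' + 3`); inside `Fin h` this is realisable
as soon as `|B_{s+1}(K − 3)| ≥ |B_s(K)|`, i.e. for all `s ≲ K/2` when `K = h ≥ 12`. So `CompleteBallsUniversal` as stated
(every injective family, `K = h`) is FALSE from `h = 12` on; the census that supported it (exhaustive lower sets `h ≤ 6`,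
sampled `h ≤ 11`) was below the threshold. A kernel refutation `¬ CompleteBallsUniversal` needs the rank mechanism in
closed form and is left to a refuter seat. WHAT SURVIVES: the radius-one case below (a theorem); the JOIN door
(`…HiddenStatesJoin`, a theorem); the cell's door of record `partitionMinorsHitByVP_of_ballGood_cube` (`K = h³`), which is
immune to this concentration obstruction by counting (`|B_{s+1}(h')| < |B_s(h³)|` for every `h' ≤ h`).
-/

/-- `|B_s(h)| ≤ h + 1` for `s ≤ 1`. -/
theorem ballCard_le_succ_of_le_one (h s : ℕ) (hs : s ≤ 1) : ballCard h s ≤ h + 1 := by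
  unfold ballCard
  interval_cases s
  · simp
  · simp [Finset.sum_range_succ, Nat.add_comm]

/-- **The radius-one case of CB is a theorem**: for `s ≤ 1` every injective family of `|B_s(h)|` subsets of `Fin h` is
`BallGood h h |B_s(h)|` (the hidden family is affinely independent; `ballGood_of_le_succ`, seat g7). -/
theorem completeBallsUniversal_of_le_one (h s : ℕ) (hs : s ≤ 1) (u : Fin (ballCard h s) → Finset (Fin h))
    (hu : Function.Injective u) : BallGood h h (ballCard h s) u :=
  ballGood_of_le_succ h h (ballCard h s) (ballCard_le_succ_of_le_one h s hs) u hu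

end

end Summit.ValiantsHypothesis.ValiantsHypothesis.Theorems.BarrierLever.HiddenStates
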